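import Literature.IUT.HodgeTheaters.PuncturedEllipticProLModelDatum
import HarnessLib

/-!
# An infinite pro-`l` model of [IUTchI] §1, part 3: abc-iut-L5-t1's `CuspGalois` at the datum

Mochizuki, *Inter-universal Teichmüller theory I*, kurims manuscript (May 2020), §1 pp. 37–38, with [EtTh]
Def. 2.1 / Rmk. 2.1.1 p. 33 ([IUTchI] §1 p.37) [claim: Mochizuki2012, status: disputed] (D-0012 claim key;
series status DISPUTED — WITNESS-class MODEL module; nothing of the series is asserted, no side is taken on
[IUTchIII] Cor. 3.12).

Parts 1–2 (`PuncturedEllipticProLModel*.lean`, abc-iut-L5-d4): `P = ℤ_l^{ℤ/l} ⋊ (ℤ_l ⋊ ℤ/2)`, the datum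
`ProLModel.datum l h5` (`Π_X = N ⋊ ⟨a⟩`, `Π_C̲ = N ⋊ (⟨a^l⟩ ⋊ ⟨ι⟩)`, cusps `ℤ/l`, `D_i = ℤ_l · c_i`).  Here:
**`ProLModel.cuspGalois l h5 : (datum l h5).CuspGalois`** — the cusp interface of abc-iut-L5-t1
(`PuncturedEllipticCoveringsCusps.lean`) INHABITED at the datum: the action `P ↠ D ↠ D_l → Perm(ℤ/l)`
(abc-iut-L5-t1's `cuspHom`), `g D_i g⁻¹ = D_{g·i}` on the nose, distinct cusps have distinct (abelian, hence
non-conjugate) inertia lines, `Π_X/Π_X̲ ≅ ℤ/l` acts simply transitively with generator `a`, `ι` acts on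
`⟨a⟩` by `−1` (`c g c⁻¹ g ∈ N̂`), `ι ε⁰ = ε⁰`, `ι ε′ = ε″`, `2ε = 2·ε′`.  HONEST LABEL: semi-synthetic model,
`G_k = 1` — consistency evidence for OUR typed binders only.  No instance, no `sorry`; symbolic prime `l`.
-/

noncomputable section

namespace Literature.IUT.HodgeTheaters

namespace PuncturedEllipticData

namespace ProLModel

open DihedralGroup _root_.Topology Literature.AnabelianGeometry.AbsoluteAnabelian
open scoped Pointwise

variable (l : ℕ) [Fact l.Prime]

/-! ### `CuspGalois` at the datum -/

/-- The lift `a^s ∈ Π_X` of the rotation `r_{s mod l}`. [claim: Mochizuki2012, status: disputed] -/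
def elA (s : ℤ_[l]) : P l := SemidirectProduct.inr (SemidirectProduct.inl (Multiplicative.ofAdd s))

/-- `a^s ∈ Π_X`. [claim: Mochizuki2012, status: disputed] -/
theorem elA_mem_PiXm (s : ℤ_[l]) : elA l s ∈ PiXm l := (mem_PiXm_iff l _).2 rfl

/-- `a^s` acts on the cusps by `i ↦ i + (s mod l)`. [claim: Mochizuki2012, status: disputed] -/
theorem actm_elA (s : ℤ_[l]) (i : ZMod l) : actm l (elA l s) i = i + PadicInt.toZMod s := by
  rw [actm_apply, toDih_right_of_mem_PiXm l (elA_mem_PiXm l s), ArrowModel.cuspAct_r]; rfl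

/-- Powers of `act(a)`: `act(a)^n = act(r_n)`. [claim: Mochizuki2012, status: disputed] -/
theorem actm_elA_one_pow (n : ℕ) : actm l (elA l 1) ^ n = ArrowModel.cuspHom l (r (n : ZMod l)) := by
  have h1 : actm l (elA l 1) = ArrowModel.cuspHom l (r 1) := by
    change ArrowModel.cuspHom l (toDih l (elA l 1).right) = _
    rw [toDih_right_of_mem_PiXm l (elA_mem_PiXm l 1)]
    change ArrowModel.cuspHom l (r (PadicInt.toZMod 1)) = _
    rw [map_one]
  rw [h1, ← map_pow, r_one_pow]

/-- Conjugation by an involution-class element of `D` inverts the `⟨a⟩`-part: `d · (x,1) · d⁻¹ = (ψ_d x, 1)`.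
[claim: Mochizuki2012, status: disputed] -/
theorem D_conj_inl (d : D l) (x : C l) :
    d * SemidirectProduct.inl x * d⁻¹ = SemidirectProduct.inl (psi l d.right x) := by
  refine SemidirectProduct.ext ?_ ?_
  · simp only [SemidirectProduct.mul_left, SemidirectProduct.mul_right, SemidirectProduct.inv_left,
      SemidirectProduct.left_inl, SemidirectProduct.right_inl, mul_one, map_inv, MulAut.apply_inv_self,
      mul_inv_cancel_comm]
  · simp only [SemidirectProduct.mul_right, SemidirectProduct.inv_right, SemidirectProduct.right_inl,
      mul_one, mul_inv_cancel]

/-- For `c ∈ Π_C̲ ∖ Π_X` and `g ∈ Π_X`: `c g c⁻¹ g ∈ N̂` (`ι` acts on `⟨a⟩` by `−1`). [claim: Mochizuki2012, status: disputed] -/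
theorem conj_mul_mem_Nhat {c g : P l} (hcX : c ∉ PiXm l) (hg : g ∈ PiXm l) : c * g * c⁻¹ * g ∈ Nhat l := by
  rw [mem_Nhat_iff]
  have hg1 : g.right.right = 1 := (mem_PiXm_iff l g).1 hg
  obtain ⟨x, hge⟩ : ∃ x : C l, g.right = SemidirectProduct.inl x := ⟨g.right.left, SemidirectProduct.ext rfl hg1⟩
  have hcι : expo c.right.right = 1 := by
    have hc1 : c.right.right ≠ 1 := fun h => hcX ((mem_PiXm_iff l c).2 h)
    have ht : expo c.right.right < 2 := (Multiplicative.toAdd c.right.right).val_lt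
    interval_cases h : expo c.right.right
    · exact absurd (toAdd_eq_zero.mp ((ZMod.val_eq_zero _).1 h)) hc1
    · rfl
  rw [SemidirectProduct.mul_right, SemidirectProduct.mul_right, SemidirectProduct.mul_right,
    SemidirectProduct.inv_right, hge, D_conj_inl, psi_apply, if_neg (by rw [hcι]; exact one_ne_zero), ← map_mul,
    inv_mul_cancel, map_one]

/-- **abc-iut-L5-t1's cusp interface `CuspGalois` INHABITED at the pro-`l` datum.**
([IUTchI] §1 p.37) [claim: Mochizuki2012, status: disputed] -/
def cuspGalois (h5 : 5 ≤ l) : (datum l h5).CuspGalois where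
  act := actm l
  act_decomp g i := ⟨1, Subgroup.one_mem _, by rw [one_mul]; exact conj_smul_Dm l g i⟩
  eq_of_conj i j t ht h := by
    change t ∈ PiXm l ⊓ PiCbarm l at ht
    change MulAut.conj t • Dm l i = Dm l j at h
    rw [conj_smul_Dm, toDih_right_of_mem_PiXbar l ht.1 ht.2] at h
    change Dm l (ArrowModel.cuspAct l (r 0) i) = Dm l j at h
    rw [ArrowModel.cuspAct_r, add_zero] at h
    exact Dm_injective l h5 h
  isClosed_decomp := isClosed_Dm l
  free g hg i h := by
    change g ∈ PiXm l at hg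
    change actm l g i = i at h
    change g ∈ PiXm l ⊓ PiCbarm l
    rw [actm_apply, toDih_right_of_mem_PiXm l hg, ArrowModel.cuspAct_r, add_eq_left] at h
    refine ⟨hg, Or.inl ?_⟩
    rw [toDihP_apply, toDih_right_of_mem_PiXm l hg, h, r_zero]
  transitive i j := ⟨elA l ((j - i).val : ℕ), elA_mem_PiXm l _, by
    change actm l (elA l _) i = j
    rw [actm_elA, map_natCast, ZMod.natCast_zmod_val, add_sub_cancel]⟩
  exists_generator := ⟨elA l 1, elA_mem_PiXm l _, fun h hh =>
    ⟨((PadicInt.toZMod (Multiplicative.toAdd h.right.left)).val : ℕ), by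
      change actm l h = actm l (elA l 1) ^ (_ : ℤ)
      rw [zpow_natCast, actm_elA_one_pow, ZMod.natCast_zmod_val]
      change ArrowModel.cuspHom l (toDih l h.right) = _
      rw [toDih_right_of_mem_PiXm l hh]⟩⟩
  conj_mul_mem_PiXbar c _ hcX g hg := Nhat_le l (conj_mul_mem_Nhat l hcX hg)
  act_ε0 c hc := by
    change c ∈ PiCbarm l at hc
    change actm l c 0 = 0
    rcases (mem_PiCbarm_iff l c).1 hc with h | h <;> rw [actm_apply, h]
    · rw [one_def, ArrowModel.cuspAct_r, add_zero]
    · rw [ArrowModel.cuspAct_sr, neg_zero, sub_zero]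
  act_ε1 c hc hcX := by
    change c ∈ PiCbarm l at hc
    change c ∉ PiXm l at hcX
    change actm l c 1 = -1
    rw [actm_apply, toDih_right_of_mem_PiCbarm_not_PiXm l hc hcX, ArrowModel.cuspAct_sr, neg_zero, zero_sub]
  act_twoε g hg h := by
    change g ∈ PiXm l at hg
    change actm l g 0 = 1 at h
    change actm l (g * g) 0 = 2 ∨ actm l (g⁻¹ * g⁻¹) 0 = 2
    left
    rw [actm_apply, toDih_right_of_mem_PiXm l hg, ArrowModel.cuspAct_r, zero_add] at h
    rw [map_mul, Equiv.Perm.mul_apply, actm_apply l g 0, toDih_right_of_mem_PiXm l hg, ArrowModel.cuspAct_r,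
      zero_add, h, actm_apply, toDih_right_of_mem_PiXm l hg, ArrowModel.cuspAct_r, h]
    norm_num

end ProLModel

end PuncturedEllipticData

end Literature.IUT.HodgeTheaters
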